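import Literature.MathematicalPhysics.QuantumFieldTheory.Balaban1983to89.B8Eq1101CubeMemberReal
import Literature.MathematicalPhysics.QuantumFieldTheory.Balaban1983to89.B8Eq140Level

/-!
# `Balaban1983to89.B8Eq1101CubeMemberRealGrad` — [Balaban1985RegularSpaces] (1.101) AT `U₀ = 1` ON THE CUBE MEMBER `{□_j}` OF (1.131): THE COMPLETE REAL-1 FAMILY
# of `B8Prop6CubeMemberFlatScalar.prop6_cubeMember_flat_of_real` — function member `|φ| ≤ B_G r` AND gradient member `wt(j)|η⁻¹Δφ| ≤ B_G r` on the bonds of the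
# plaquettes touching `□_j` — PROVED ([Balaban1985BackgroundPropagators] Theorem 3.1 p. 397 at `U = 1`, Dirichlet on `□₀`: «… and the norm |·|₍₋₁₎ for their first derivatives»)

statement-level skeleton of published theorems with citation tags; proofs where landed; nothing here is a claim about the
Yang–Mills mass gap

`[Balaban1985RegularSpaces]` ("B8", CMP **99** (1985) 75–102) (1.101) p. 93, p. 77 (touching convention for bonds and plaquettes), (1.2) p. 76, p. 98, (1.131) p. 99;
`[Balaban1985BackgroundPropagators]` ("[4]") Theorem 3.1 (3.42) p. 397, (3.47) p. 398; `[Balaban1984PropagatorsII]` ("B6") p. 228, (2.46)–(2.58) p. 231–233, Prop. 2.2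
(2.67) p. 234.  PDF held: `paper:balaban1985-cmp99-regular-spaces-gauge-fixing`.

CITATION HEADER (lean-in-tree rule).  Cell `pub-ymgap` (YM Track A, HUMAN RULING D-0062), DAG node N05 = [B8], seat `pub-ymgap-dag-n05-c` (g9; (R1′)-v2 HYBRID
route, file F4d — the closing file of the REAL-1 line).  F4c `B8Eq1101CubeMemberReal.ineq1101_cubeMember_sup` (p544259) proved the function member; THIS FILE adds
the gradient member and states BOTH in the consumer's shape.  New ingredient: the geometry of «the bonds of the plaquettes touching `□_j`» (n05-e's
`SideTouches (cubeFam false L a M ρ k j)`): both ends of such a bond are coordinatewise within `1` of a site of `□_j`, hence (for `j ≥ 2`) lie in `□_{j−1}` and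
are deeper than `4s` into `□₁`, where the parametrix is the pure region-A field and r05's gradient entry of (1.101) applies at the level `≥ j − 1` of the
host box; the a-priori lemma of F4c is applied to the functional `Lʲ(ψ(y+e_μ) − ψ(y))`.  For `j ≤ 1` the gradient member follows from the function member.

WHAT THIS FILE PROVES (kernel-checked; theorems only).
* §1 `plaq_corners_close`, `corner_form`, ★ `close_of_sideTouches` (a bond on a plaquette touching `Ω` has both ends coordinatewise within `1` of one site of `Ω`).
* §2 `mem_cube_pred_of_close` (`1`-close to `□_j` ⇒ in `□_{j−1}`, collar width `ρL^{j−1} ≥ 1`), `l1dist_le_of_close`, `depth_ge_of_close` (depth into `□₁` drops by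
  at most `d + 1`).
* §3 ★★★ `ineq1101_cubeMember_real` — under the data of F4c (`∃ B_G ρ₀ M₀ N₀` functions of `d, ℓ`; admissible cube data on the big-block sub-lattice; weights tied
  to p21's recursion in `[4, 8]`; the consumer's explicit `T = Matrix.of K`; sources with `wt(j)²|ρ′| ≤ r` on `□_j`; `φ = T⁻¹ρ′` extended by zero):
  `(∀ x, |φ x| ≤ B_G r) ∧ (∀ j ≤ n, ∀ p ∈ {b | SideTouches (□_j) b.1 b.2}, wt (ℓ+1) η j * |η⁻¹ * (φ (p.1 + e p.2) − φ p.1)| ≤ B_G r)` — the consumer's REAL-1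
  hypothesis VERBATIM (both members, same constant `B_G = 4L(C′_A + C_W)`), at `L = ℓ + 1`, dimension `d + 1`.

HONEST SCOPE ∕ NOT CLAIMED.  As F4c: data restricted to print's sub-lattice («□_j is a sum of the big blocks», «M a multiple of R₁M₁», `R₁M₁ ≥ ρ₀(d,L)`, p21∕r05
thresholds) — the consumer quantifies `∀ M ρ` with `L ≤ ρ ≤ M` only; weights tied to p21's recursion (`aPrinted 8` qualifies); constants existential and far from
print's; REAL-2 ((1.92) + Δ-entry) and REAL-3 ((1.98)) are NOT touched (they need the tower-range inverse `(QT⁻²Qᵀ)⁻¹` of the GLUED operator — a Prop. 2.3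
analogue; p21's `prop23_multiLevelBox` serves region A only).  `set_option maxHeartbeats 400000` for the one long assembly proof (twice the default; the
statement elaborates ≈40 hypotheses).  Count-neutral; N05 NOT discharged; one finite `T⁴` programme at fixed `ε`, Bałaban as printed; nothing continuum ∕ ℝ⁴ ∕ OS ∕
mass-gap ∕ Clay.  No `sorry`, no `def`, no `instance`, no `notation`.  Unit `pub-ymgap-dag-n05-c` (g9), 2026-08-27.

RELATED IN THE TREE, NOT DUPLICATED: `B8Eq1101CubeMemberReal.*` (F4c: the a-priori lemma and the function member, USED), F1–F4b of this route (USED BY NAME),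
`B8Eq140Level.SideTouches` ∕ `B8Ineq132.PlaqTouches` (n05's touching predicates, READ), `B8Prop6CubeMemberEq137.sideTouches_top_of_bondBox` (the converse-direction
geometry at the top cube, not needed here).
-/
noncomputable section

namespace Literature.MathematicalPhysics.QuantumFieldTheory.Balaban1983to89.B8Eq1101CubeMemberRealGrad

open B7Prop1Explicit (e)
open B8Eq131Cubes (cube l1dist)
open B8Eq140Level (SideTouches IsSide)
open B8Ineq132 (PlaqTouches)
open B8Eq191FlatDirichletDepth (depth fm loC hiC mem_cube_iff_inBox fm_succ)
open B8Eq1101CubeMemberCutoffs (abs_depth_sub_le_l1dist)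

variable {d : ℕ}

/-! ## §1 Bonds on plaquettes touching `□_j`: both ends are coordinatewise within `1` of a site of `□_j` -/

/-- Two corners of one plaquette `p_{κν}(z)` (`κ ≠ ν`) are coordinatewise within `1`. [cite: Balaban1985RegularSpaces, (1.2) p.76, p.77 (touching convention)] -/
theorem plaq_corners_close {z : Fin d → ℤ} {κ ν : Fin d} (hκν : κ ≠ ν) {α β α' β' : ℤ}
    (hα : 0 ≤ α ∧ α ≤ 1) (hβ : 0 ≤ β ∧ β ≤ 1) (hα' : 0 ≤ α' ∧ α' ≤ 1) (hβ' : 0 ≤ β' ∧ β' ≤ 1) (i : Fin d) :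
    |(z + α • e κ + β • e ν) i - (z + α' • e κ + β' • e ν) i| ≤ 1 := by
  simp only [Pi.add_apply, Pi.smul_apply, e, smul_eq_mul]
  by_cases hi : i = κ
  · subst hi
    simp only [Pi.single_eq_same, Pi.single_eq_of_ne hκν, mul_one, mul_zero, add_zero]
    rw [abs_le]; constructor <;> linarith
  · by_cases hi' : i = ν
    · subst hi'
      simp only [Pi.single_eq_same, Pi.single_eq_of_ne hi, mul_one, mul_zero, add_zero]
      rw [abs_le]; constructor <;> linarith
    · simp only [Pi.single_eq_of_ne hi, Pi.single_eq_of_ne hi', mul_zero, add_zero, sub_self, abs_zero]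
      norm_num

/-- The four corners of `p_{κν}(z)` in the form `z + αe_κ + βe_ν`. [cite: Balaban1985RegularSpaces, (1.2) p.76] -/
theorem corner_form (z : Fin d → ℤ) (κ ν : Fin d) (w : Fin d → ℤ)
    (hw : w = z ∨ w = z + e κ ∨ w = z + e ν ∨ w = z + e κ + e ν) :
    ∃ α β : ℤ, (0 ≤ α ∧ α ≤ 1) ∧ (0 ≤ β ∧ β ≤ 1) ∧ w = z + α • e κ + β • e ν := by
  rcases hw with h | h | h | h
  · exact ⟨0, 0, by norm_num, by norm_num, by rw [h]; simp⟩
  · exact ⟨1, 0, by norm_num, by norm_num, by rw [h]; simp⟩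
  · exact ⟨0, 1, by norm_num, by norm_num, by rw [h]; simp⟩
  · exact ⟨1, 1, by norm_num, by norm_num, by rw [h]; simp⟩

/-- **A BOND ON A PLAQUETTE TOUCHING `Ω` IS COORDINATEWISE WITHIN `1` OF `Ω`** (both of its ends, from the same site of `Ω`).
[cite: Balaban1985RegularSpaces, p.77 («we denote by Ω also the set of bonds … Similarly for the corresponding set of plaquettes»), (1.2) p.76] -/
theorem close_of_sideTouches {Ω : Set (Fin d → ℤ)} {y : Fin d → ℤ} {μ : Fin d} (h : SideTouches Ω y μ) :
    ∃ c ∈ Ω, (∀ i, |y i - c i| ≤ 1) ∧ (∀ i, |(y + e μ) i - c i| ≤ 1) := by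
  obtain ⟨z, κ, ν, hκν, hP, hS⟩ := h
  -- the corner in `Ω`
  obtain ⟨c, hcΩ, hc⟩ : ∃ c ∈ Ω, (c = z ∨ c = z + e κ ∨ c = z + e ν ∨ c = z + e κ + e ν) := by
    rcases hP with h | h | h | h
    · exact ⟨_, h, Or.inl rfl⟩
    · exact ⟨_, h, Or.inr (Or.inl rfl)⟩
    · exact ⟨_, h, Or.inr (Or.inr (Or.inl rfl))⟩
    · exact ⟨_, h, Or.inr (Or.inr (Or.inr rfl))⟩
  obtain ⟨αc, βc, hαc, hβc, hceq⟩ := corner_form z κ ν c hc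
  -- the two ends of the side
  have hy : (y = z ∨ y = z + e κ ∨ y = z + e ν ∨ y = z + e κ + e ν) ∧
      (y + e μ = z ∨ y + e μ = z + e κ ∨ y + e μ = z + e ν ∨ y + e μ = z + e κ + e ν) := by
    rcases hS with ⟨h1, h2⟩ | ⟨h1, h2⟩ | ⟨h1, h2⟩ | ⟨h1, h2⟩ <;> subst h1 <;> subst h2
    · exact ⟨Or.inl rfl, Or.inr (Or.inl rfl)⟩
    · exact ⟨Or.inr (Or.inl rfl), Or.inr (Or.inr (Or.inr rfl))⟩
    · exact ⟨Or.inr (Or.inr (Or.inl rfl)), Or.inr (Or.inr (Or.inr (by abel)))⟩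
    · exact ⟨Or.inl rfl, Or.inr (Or.inr (Or.inl rfl))⟩
  obtain ⟨α₁, β₁, hα₁, hβ₁, h₁⟩ := corner_form z κ ν y hy.1
  obtain ⟨α₂, β₂, hα₂, hβ₂, h₂⟩ := corner_form z κ ν (y + e μ) hy.2
  refine ⟨c, hcΩ, fun i => ?_, fun i => ?_⟩
  · rw [h₁, hceq]; exact plaq_corners_close hκν hα₁ hβ₁ hαc hβc i
  · rw [h₂, hceq]; exact plaq_corners_close hκν hα₂ hβ₂ hαc hβc i

/-! ## §2 A site coordinatewise within `1` of `□_j` lies in `□_{j−1}` and is nearly as deep into `□₁` -/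

/-- `c ∈ □_j`, `|w − c|_∞ ≤ 1`, `1 ≤ j ≤ k`, `ρ ≥ 1` ⇒ `w ∈ □_{j−1}` (the collar between the two cubes has width `ρL^{j−1} ≥ 1`).
[cite: Balaban1985RegularSpaces, p.98 («a distance between boundaries of these cubes is equal to R₁M₁Lʲη»)] -/
theorem mem_cube_pred_of_close {L : ℕ} (hL : 1 ≤ L) (a : Fin d → ℤ) (M : ℕ) {ρ k j : ℕ} (hρ : 1 ≤ ρ) (hj : 1 ≤ j) (hjk : j ≤ k)
    {c w : Fin d → ℤ} (hc : c ∈ cube L a M ρ k j) (hw : ∀ i, |w i - c i| ≤ 1) : w ∈ cube L a M ρ k (j - 1) := by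
  obtain ⟨j', rfl⟩ : ∃ j', j = j' + 1 := ⟨j - 1, by omega⟩
  rw [Nat.add_sub_cancel]
  have hj'k : j' < k := Nat.lt_of_succ_le hjk
  rw [mem_cube_iff_inBox a M ρ hjk] at hc
  rw [mem_cube_iff_inBox a M ρ hj'k.le]
  intro i
  obtain ⟨h1, h2⟩ := hc i
  have hw' := hw i
  rw [abs_le] at hw'
  have hs := fm_succ (L := L) (ρ := ρ) hj'k
  have hpos : (1 : ℤ) ≤ ((ρ * L ^ j' : ℕ) : ℤ) := by
    have : 1 ≤ ρ * L ^ j' := Nat.mul_pos (by omega) (Nat.one_le_pow _ _ hL)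
    exact_mod_cast this
  have e1 : loC L a ρ k j' i = loC L a ρ k (j' + 1) i - ((ρ * L ^ j' : ℕ) : ℤ) := by
    unfold loC; simp only [B8Eq131Cubes.bLo]; rw [hs]; push_cast; ring
  have e2 : hiC L a M ρ k j' i = hiC L a M ρ k (j' + 1) i + ((ρ * L ^ j' : ℕ) : ℤ) := by
    unfold hiC; simp only [B8Eq131Cubes.bHi]; rw [hs]; push_cast; ring
  rw [e1, e2]
  constructor <;> linarith

/-- Coordinatewise `1`-close sites are `ℓ¹`-close: `|w − c|₁ ≤ d`. [folklore] [cite: Balaban1984PropagatorsII, (2.46) p.231] -/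
theorem l1dist_le_of_close {w c : Fin d → ℤ} (hw : ∀ i, |w i - c i| ≤ 1) : l1dist w c ≤ d := by
  calc l1dist w c = ∑ i, |w i - c i| := rfl
    _ ≤ ∑ _i : Fin d, (1 : ℤ) := Finset.sum_le_sum fun i _ => hw i
    _ = d := by simp

/-- Hence the depth into `□₁` of a `1`-close site differs by at most `d`. [cite: Balaban1984PropagatorsII, (2.46) p.231] -/
theorem depth_ge_of_close (hd : 0 < d) (L : ℕ) (a : Fin d → ℤ) (M ρ k : ℕ) {w c : Fin d → ℤ} (hw : ∀ i, |w i - c i| ≤ 1) :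
    depth hd L a M ρ k 1 c - d ≤ depth hd L a M ρ k 1 w := by
  have h := abs_depth_sub_le_l1dist hd L a M ρ k 1 w c
  have h2 := l1dist_le_of_close hw
  rw [abs_le] at h
  linarith [h.1]

/-! ## §3 (1.101) ON THE CUBE MEMBER IN THE CONSUMER'S SHAPE: BOTH MEMBERS OF REAL-1 -/

open scoped Matrix
open B6MultiLevelBoxOperator (N0 mlOp gml levC)
open B6Prop22DerivMultiLevelBox (dMat)
open B6Ineq243TwoLevelBox (aNext)
open B4Reflection242 (boxDom)
open B8Eq131CubesAdmissible (cubeFam cubeFam_false_of_le)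
open B8CubeMemberZd (cubeLamS)
open B8LambdaSpaceKLevel (wt)
open B8Eq191FlatDirichletForm (isUnit_flatMatrix)
open B8CubeMemberBoxDomains (shift boxP lev ineq1101_regionA)
open B8Eq1101CubeMemberCutoffs (cutA cutAt cutB cutBt wall wall_subset)
open B8Eq1101CubeMemberParametrixIdentity (parametrix_identity regionA_bounds regionB_bound parametrix_sup commutator_bound parametrix_grad_deep)
open B8Eq1101CubeMemberReal (apriori_functional_bound dite_shift_apply dite_mem_apply)
open Literature.MathematicalPhysics.QuantumLattice (blockMap)

set_option maxHeartbeats 400000 in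
open Classical in
/-- **[Balaban1985RegularSpaces] (1.101) AT `U₀ = 1` ON THE CUBE MEMBER — THE COMPLETE REAL-1 FAMILY OF `prop6_cubeMember_flat_of_real`** («G′ is a bounded
operator from a space with the norm |·|₍₋₂₎ into a space with the norm |·| for functions, and the norm |·|₍₋₁₎ for their first derivatives»): under the data
of `B8Eq1101CubeMemberReal.ineq1101_cubeMember_sup`, for every source `ρ′` with `wt(j)²|ρ′| ≤ r` on `□_j` and `φ = T⁻¹ρ′` extended by zero:
`(∀ x, |φ x| ≤ B_G·r) ∧ (∀ j ≤ n, ∀ bonds ⟨y, y+e_μ⟩ on plaquettes touching □_j, wt(j)·|η⁻¹(φ(y+e_μ) − φ(y))| ≤ B_G·r)`, `B_G = 4L(C′_A + C_W)`.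
The gradient member: for `j ≤ 1` from the function member (`Lʲ ≤ L`); for `j ≥ 2` both ends of the bond are coordinatewise within `1` of `□_j ⊂ □₂` (§1), hence in
`□_{j−1}` and deeper than `4s` into `□₁` (§2), where `P u` is the pure region-A field (F4b `parametrix_grad_deep`) whose gradient r05 bounds by
`C′N(L^{lev})⁻¹ ≤ C′N·L·L^{−j}`; the a-priori lemma of F4c applied to the functional `Lʲ(ψ(y+e_μ) − ψ(y))` concludes.
[cite: Balaban1985RegularSpaces, (1.101) p.93, p.98, (1.131) p.99, p.77; Balaban1985BackgroundPropagators, Theorem 3.1 (3.42) p.397, (3.47) p.398; Balaban1984PropagatorsII, p.228, (2.47)–(2.58) p.231–233, Prop. 2.2 (2.67) p.234] -/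
theorem ineq1101_cubeMember_real (d ℓ : ℕ) (hℓ : 1 ≤ ℓ) :
    ∃ BG ρ₀ M₀ : ℝ, ∃ N₀ : ℕ, 0 < BG ∧ 0 < M₀ ∧ 0 < N₀ ∧
      ∀ (η : ℝ), 0 < η → ∀ (Mh : ℕ), 3 ≤ Mh → M₀ ≤ ((ℓ : ℝ) + 1) * Mh →
      ∀ (a : Fin (d + 1) → ℤ) (M ρ k n R : ℕ), 1 ≤ n → n ≤ k → Mh * (ℓ + 1) ∣ ρ → Mh * (ℓ + 1) ∣ M → 0 < ρ →
        R * (Mh * (ℓ + 1)) ≤ ρ → 2 * (ℓ + 1) ≤ R → N₀ + 1 ≤ R * ((ℓ + 1) * Mh) → ρ₀ ≤ (ρ : ℝ) →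
      ∀ (aw c : ℕ → ℝ), (∀ i, 1 ≤ i → 4 ≤ aw i ∧ aw i ≤ 8) → (∀ i, 1 ≤ i → 4 ≤ c i ∧ c i ≤ 8) →
        (∀ i, 1 ≤ i → aw (i + 1) = aNext ℓ (aw i) (c i)) → (∀ j, 0 < aw j) →
      ∀ (w : ℕ → ℝ), (∀ j, 0 < w j) →
        (∀ j, 1 ≤ j → j ≤ n → w j * (((((ℓ + 1 : ℕ) : ℝ) ^ (d + 1))⁻¹) ^ j) ^ 2 = (η ^ 2)⁻¹ * levC d ℓ aw j) →
        (∀ j, j ≤ n → 4 ≤ w j * η ^ 2 * (((ℓ + 1 : ℕ) : ℝ) ^ j) ^ 2 * (((((ℓ + 1 : ℕ) : ℝ)) ^ (d + 1)) ^ j)⁻¹ ∧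
          w j * η ^ 2 * (((ℓ + 1 : ℕ) : ℝ) ^ j) ^ 2 * (((((ℓ + 1 : ℕ) : ℝ)) ^ (d + 1)) ^ j)⁻¹ ≤ 8) →
      ∀ (S : Finset (Fin (d + 1) → ℤ)), (∀ z, z ∈ S ↔ z ∈ cubeFam false (ℓ + 1) a M ρ k 0) →
      ∀ (K : (Fin (d + 1) → ℤ) → (Fin (d + 1) → ℤ) → ℝ), (∀ x z, K x z =
          ((η ^ 2)⁻¹ * ∑ μ : Fin (d + 1), ((2 : ℝ) * (if z = x then (1 : ℝ) else 0) - (if z = x + e μ then (1 : ℝ) else 0)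
            - (if z = x - e μ then (1 : ℝ) else 0))) +
          (∑ j ∈ Finset.range (n + 1), (if blockMap ((ℓ + 1) ^ j) x ∈ cubeLamS (ℓ + 1) a M ρ k n j ∧
              blockMap ((ℓ + 1) ^ j) z = blockMap ((ℓ + 1) ^ j) x then
            w j * (((((ℓ + 1 : ℕ) : ℝ) ^ (d + 1))⁻¹) ^ j) ^ 2 else 0))) →
      ∀ (T : Matrix ↥S ↥S ℝ), T = Matrix.of (fun x z : ↥S => K x.1 z.1) →
      ∀ (ρ' : ↥S → ℝ) (r : ℝ), 0 ≤ r →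
        (∀ j, j ≤ n → ∀ z : ↥S, z.1 ∈ cubeFam false (ℓ + 1) a M ρ k j → wt (ℓ + 1) η j ^ 2 * |ρ' z| ≤ r) →
        ∀ φ : (Fin (d + 1) → ℤ) → ℝ, (∀ x, x ∉ cubeFam false (ℓ + 1) a M ρ k 0 → φ x = 0) →
          (∀ v : ↥S, φ v.1 = ∑ z : ↥S, T⁻¹ v z * ρ' z) →
          (∀ x, |φ x| ≤ BG * r) ∧
          ∀ j, j ≤ n → ∀ p ∈ {b : (Fin (d + 1) → ℤ) × Fin (d + 1) | SideTouches (cubeFam false (ℓ + 1) a M ρ k j) b.1 b.2},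
            wt (ℓ + 1) η j * |η⁻¹ * (φ (p.1 + e p.2) - φ p.1)| ≤ BG * r := by
  have hd : 0 < d + 1 := Nat.succ_pos d
  have hL : 1 ≤ ℓ + 1 := Nat.succ_pos ℓ
  have hLr : (1 : ℝ) ≤ ((ℓ + 1 : ℕ) : ℝ) := by exact_mod_cast hL
  have hLpos : (0 : ℝ) < ((ℓ + 1 : ℕ) : ℝ) := by positivity
  -- region A's (1.101) package (p21 ∕ r05 via F1), weight windows `[4, 8]`
  obtain ⟨C', M₀, N₀, hC', hM₀, hN₀, hregA⟩ := ineq1101_regionA d ℓ hℓ 4 8 4 8 (by norm_num) (by norm_num)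
  -- the wall constant (F3 at `a₀ = 4`, `θ = ½`, `δ′ = 1/(2(d+1))`)
  set CW : ℝ := (((ℓ + 1 : ℕ) : ℝ)) ^ 2 / (4 * (1 - 1 / 2)) * B6.c0 1 (1 / (2 * ((d : ℝ) + 1)) / ((ℓ + 1 : ℕ) : ℝ)) ^ (d + 1) with hCW
  have hc0 : 1 ≤ B6.c0 1 (1 / (2 * ((d : ℝ) + 1)) / ((ℓ + 1 : ℕ) : ℝ)) := B8Eq191FlatDirichletWall.one_le_c0 (by positivity)
  have hCW0 : 0 ≤ CW := by rw [hCW]; have := hc0; positivity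
  -- the ramp-length threshold and the collar threshold
  set s₀ : ℝ := 20 * ((d : ℝ) + 1) * (((ℓ + 1 : ℕ) : ℝ)) ^ 2 * (C' + CW) with hs₀
  have hs₀0 : 0 ≤ s₀ := by rw [hs₀]; positivity
  set ρ₀ : ℝ := 4 * s₀ + 12 + ((d : ℝ) + 1) * ℓ with hρ₀
  refine ⟨4 * (((ℓ + 1 : ℕ) : ℝ)) * (C' + CW), ρ₀, M₀, N₀, by positivity, hM₀, hN₀, ?_⟩
  intro η hη Mh hMh hM0 a M ρ k n R hn hnk hρd hMd hρ0 hR hR2 hRN hρbig aw c haw hc hrec hawpos w hwpos hw hwin S hS K hK T hT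
    ρ' r hr hρ' φ hφ0 hφ
  have hη0 : η ≠ 0 := hη.ne'
  have hMh1 : 1 ≤ Mh := le_trans (by norm_num) hMh
  have hk : 1 ≤ k := hn.trans hnk
  have hρL : ℓ + 1 ≤ ρ := le_trans (Nat.le_mul_of_pos_left _ hMh1) (Nat.le_of_dvd hρ0 hρd)
  -- the ramp length `s` and the wall parameter `m_W = 4s`
  obtain ⟨s, hs⟩ : ∃ s : ℕ, s = (ρ * (ℓ + 1) - (d + 1) * ℓ) / 4 := ⟨_, rfl⟩
  have hρL' : (d + 1) * ℓ + 4 * (Nat.ceil s₀ + 1) ≤ ρ * (ℓ + 1) := by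
    have h1 : (ρ : ℝ) ≤ (ρ : ℝ) * ((ℓ + 1 : ℕ) : ℝ) := le_mul_of_one_le_right (by positivity) hLr
    have h2 : ((Nat.ceil s₀ : ℕ) : ℝ) < s₀ + 1 := Nat.ceil_lt_add_one hs₀0
    have h3 : (((d + 1) * ℓ + 4 * (Nat.ceil s₀ + 1) : ℕ) : ℝ) ≤ ((ρ * (ℓ + 1) : ℕ) : ℝ) := by
      push_cast; rw [hρ₀] at hρbig; push_cast at h1; nlinarith
    exact_mod_cast h3
  have hs_ge : Nat.ceil s₀ + 1 ≤ s := by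
    rw [hs, Nat.le_div_iff_mul_le (by norm_num)]; omega
  have hs1 : 1 ≤ s := le_trans (by omega) hs_ge
  have hss₀ : s₀ ≤ s := (Nat.le_ceil s₀).trans (by exact_mod_cast (by omega : Nat.ceil s₀ ≤ s))
  have hs4 : 4 * s + (d + 1) * ℓ ≤ ρ * (ℓ + 1) := by
    rw [hs]; have := Nat.div_mul_le_self (ρ * (ℓ + 1) - (d + 1) * ℓ) 4; omega
  have hmWρ : ((4 * s : ℕ) : ℤ) + (d + 1 : ℕ) * ((ℓ + 1 : ℕ) - 1 : ℤ) ≤ ρ * (ℓ + 1 : ℕ) := by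
    have : (((4 * s + (d + 1) * ℓ : ℕ)) : ℤ) ≤ ((ρ * (ℓ + 1) : ℕ) : ℤ) := by exact_mod_cast hs4
    push_cast at this ⊢; linarith
  have hρs : 4 * (s : ℤ) ≤ ρ * (ℓ + 1 : ℕ) := by
    have : (((4 * s : ℕ)) : ℤ) ≤ ((ρ * (ℓ + 1) : ℕ) : ℤ) := by exact_mod_cast (le_trans (Nat.le_add_right _ _) hs4)
    push_cast at this ⊢; linarith
  have hs0r : (0 : ℝ) < s := by exact_mod_cast hs1
  -- the size predicate and the explicit operators of the parametrix, as functions of the source `u`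
  obtain ⟨BW, hBW⟩ : ∃ BW : ((Fin (d + 1) → ℤ) → ℝ) → ℝ → Prop,
      ∀ u N, BW u N ↔ ∀ j, j ≤ n → ∀ z, z ∈ cube (ℓ + 1) a M ρ k j → ((((ℓ + 1 : ℕ) : ℝ)) ^ j * η) ^ 2 * |u z| ≤ N :=
    ⟨fun u N => ∀ j, j ≤ n → ∀ z, z ∈ cube (ℓ + 1) a M ρ k j → ((((ℓ + 1 : ℕ) : ℝ)) ^ j * η) ^ 2 * |u z| ≤ N, fun _ _ => Iff.rfl⟩
  obtain ⟨uAf, huAf⟩ : ∃ uAf : ((Fin (d + 1) → ℤ) → ℝ) → ↥(boxDom (N0 ℓ Mh n (boxP ℓ M ρ k n))) → ℝ,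
      ∀ u y, uAf u y = cutA hd (ℓ + 1) a M ρ k s (y.1 - shift ℓ Mh a ρ k n) * u (y.1 - shift ℓ Mh a ρ k n) := ⟨_, fun _ _ => rfl⟩
  obtain ⟨gAxf, hgAxf⟩ : ∃ gAxf : ((Fin (d + 1) → ℤ) → ℝ) → (Fin (d + 1) → ℤ) → ℝ,
      ∀ u z, gAxf u z = if h : z + shift ℓ Mh a ρ k n ∈ boxDom (N0 ℓ Mh n (boxP ℓ M ρ k n)) then
        (gml (N0 ℓ Mh n (boxP ℓ M ρ k n)) ℓ n (lev ℓ Mh a M ρ k n) aw *ᵥ uAf u) ⟨z + shift ℓ Mh a ρ k n, h⟩ else 0 := ⟨_, fun _ _ => rfl⟩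
  obtain ⟨uBf, huBf⟩ : ∃ uBf : ((Fin (d + 1) → ℤ) → ℝ) → ↥(wall hd (ℓ + 1) a M ρ k S (4 * s)) → ℝ,
      ∀ u y, uBf u y = cutB hd (ℓ + 1) a M ρ k s y.1 * u y.1 := ⟨_, fun _ _ => rfl⟩
  obtain ⟨gBxf, hgBxf⟩ : ∃ gBxf : ((Fin (d + 1) → ℤ) → ℝ) → (Fin (d + 1) → ℤ) → ℝ,
      ∀ u z, gBxf u z = if h : z ∈ wall hd (ℓ + 1) a M ρ k S (4 * s) then
        (((Matrix.of fun x z : ↥(wall hd (ℓ + 1) a M ρ k S (4 * s)) => K x.1 z.1)⁻¹) *ᵥ uBf u) ⟨z, h⟩ else 0 := ⟨_, fun _ _ => rfl⟩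
  obtain ⟨Pf, hPf⟩ : ∃ Pf : ((Fin (d + 1) → ℤ) → ℝ) → (Fin (d + 1) → ℤ) → ℝ,
      ∀ u z, Pf u z = cutAt hd (ℓ + 1) a M ρ k s z * (η ^ 2 * gAxf u z) + cutBt hd (ℓ + 1) a M ρ k s z * gBxf u z := ⟨_, fun _ _ => rfl⟩
  obtain ⟨K₁, hK₁⟩ : ∃ K₁ : ((Fin (d + 1) → ℤ) → ℝ) → (Fin (d + 1) → ℤ) → ℝ,
      ∀ u x, K₁ u x = ∑ z ∈ S, K x z * ((cutAt hd (ℓ + 1) a M ρ k s z - cutAt hd (ℓ + 1) a M ρ k s x) * (η ^ 2 * gAxf u z)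
        + (cutBt hd (ℓ + 1) a M ρ k s z - cutBt hd (ℓ + 1) a M ρ k s x) * gBxf u z) := ⟨_, fun _ _ => rfl⟩
  obtain ⟨ψ, hψ⟩ : ∃ ψ : ((Fin (d + 1) → ℤ) → ℝ) → (Fin (d + 1) → ℤ) → ℝ,
      ∀ u x, ψ u x = if h : x ∈ S then ∑ z : ↥S, T⁻¹ ⟨x, h⟩ z * u z.1 else 0 := ⟨_, fun _ _ => rfl⟩
  -- facts about the explicit objects
  have hgAx_pull : ∀ u (y : ↥(boxDom (N0 ℓ Mh n (boxP ℓ M ρ k n)))),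
      gAxf u (y.1 - shift ℓ Mh a ρ k n) = (gml (N0 ℓ Mh n (boxP ℓ M ρ k n)) ℓ n (lev ℓ Mh a M ρ k n) aw *ᵥ uAf u) y := by
    intro u y
    have h := dite_shift_apply (shift ℓ Mh a ρ k n) (gml (N0 ℓ Mh n (boxP ℓ M ρ k n)) ℓ n (lev ℓ Mh a M ρ k n) aw *ᵥ uAf u) y
    rw [hgAxf]; exact h
  have hgBx_mem : ∀ u (y : ↥(wall hd (ℓ + 1) a M ρ k S (4 * s))),
      gBxf u y.1 = (((Matrix.of fun x z : ↥(wall hd (ℓ + 1) a M ρ k S (4 * s)) => K x.1 z.1)⁻¹) *ᵥ uBf u) y := by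
    intro u y; rw [hgBxf, dif_pos y.2]
  have hgBx0 : ∀ u z, z ∉ wall hd (ℓ + 1) a M ρ k S (4 * s) → gBxf u z = 0 := by
    intro u z hz; rw [hgBxf, dif_neg hz]
  have hw0 : ∀ j, 0 ≤ w j := fun j => (hwpos j).le
  -- (i) the bounds of the two regions for a source of size `N`
  have hregA' : ∀ (f : ↥(boxDom (N0 ℓ Mh n (boxP ℓ M ρ k n))) → ℝ) (S' : ℝ), 0 ≤ S' →
      (∀ z : ↥(boxDom (N0 ℓ Mh n (boxP ℓ M ρ k n))), |f z| ≤ S' * ((((ℓ : ℝ) + 1) ^ lev ℓ Mh a M ρ k n z.1) ^ 2)⁻¹) →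
      ∀ y : ↥(boxDom (N0 ℓ Mh n (boxP ℓ M ρ k n))),
        |(gml (N0 ℓ Mh n (boxP ℓ M ρ k n)) ℓ n (lev ℓ Mh a M ρ k n) aw *ᵥ f) y| ≤ C' * S' ∧
        ∀ μ : Fin (d + 1), |(dMat (N0 ℓ Mh n (boxP ℓ M ρ k n)) μ *ᵥ (gml (N0 ℓ Mh n (boxP ℓ M ρ k n)) ℓ n (lev ℓ Mh a M ρ k n) aw *ᵥ f)) y|
          ≤ C' * (((ℓ : ℝ) + 1) ^ lev ℓ Mh a M ρ k n y.1)⁻¹ * S' := by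
    intro f S' hS' hf y
    obtain ⟨h1, h2, -, -⟩ := hregA Mh hMh hM0 a M ρ k n R hn hnk hρd hMd hρ0 hR hR2 hRN aw c haw hc hrec f S' hS' hf y
    exact ⟨h1, h2⟩
  have hcubeS : ∀ j, j ≤ n → ∀ z, z ∈ cube (ℓ + 1) a M ρ k j → z ∈ S := by
    intro j hj z hz
    have hsub := B8Eq191FlatLettersCubeMember.cubeFam_antitone hL a M hρL k (Nat.zero_le j)
    rw [cubeFam_false_of_le _ a M ρ (hj.trans hnk)] at hsub
    exact (hS z).mpr (hsub hz)
  have hAbound : ∀ u N, 0 ≤ N → BW u N → ∀ z, η ^ 2 * |gAxf u z| ≤ C' * N := by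
    intro u N hN hu z
    rw [hBW] at hu
    rw [hgAxf]
    split_ifs with h
    · exact (regionA_bounds hMh1 a hn hnk hρd hρ0 hη aw hregA' hs1 u hN hu (uAf u) (huAf u) ⟨_, h⟩).1
    · rw [abs_zero, mul_zero]; positivity
  have hAgrad : ∀ u N, 0 ≤ N → BW u N → ∀ (y : ↥(boxDom (N0 ℓ Mh n (boxP ℓ M ρ k n)))) (μ : Fin (d + 1)),
      η ^ 2 * |(dMat (N0 ℓ Mh n (boxP ℓ M ρ k n)) μ *ᵥ (gml (N0 ℓ Mh n (boxP ℓ M ρ k n)) ℓ n (lev ℓ Mh a M ρ k n) aw *ᵥ uAf u)) y|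
        ≤ C' * N * (((ℓ : ℝ) + 1) ^ lev ℓ Mh a M ρ k n y.1)⁻¹ := by
    intro u N hN hu y μ
    rw [hBW] at hu
    exact (regionA_bounds hMh1 a hn hnk hρd hρ0 hη aw hregA' hs1 u hN hu (uAf u) (huAf u) y).2 μ
  have hBbound : ∀ u N, 0 ≤ N → BW u N → ∀ z, |gBxf u z| ≤ CW * N := by
    intro u N hN hu z
    rw [hBW] at hu
    rw [hgBxf]
    split_ifs with h
    · have hb := regionB_bound a M hρL hnk hη0 w hwpos K hK S hS (a₀ := 4) (by norm_num) (by norm_num)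
        (fun j hj => (hwin j hj).1) (fun j hj => (hwin j hj).2) (s := s) (mW := 4 * s) hmWρ u hN hu (uBf u) (huBf u) ⟨z, h⟩
      rw [hCW]; exact hb
    · rw [abs_zero]; positivity
  -- (ii) `|P u| ≤ (C′ + C_W)N`
  have hPbound : ∀ u N, 0 ≤ N → BW u N → ∀ x, |Pf u x| ≤ (C' + CW) * N := by
    intro u N hN hu x
    rw [hPf]
    have h := parametrix_sup hd (ℓ + 1) a M ρ k s (η := η) (gAxf u) (gBxf u) (hAbound u N hN hu) (hBbound u N hN hu) x
    linarith
  -- (iii) `K₁` halves the size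
  have hKhalf : ∀ u N, 0 ≤ N → BW u N → BW (K₁ u) (N / 2) := by
    intro u N hN hu
    rw [hBW]
    intro j hj z hz
    have hzS : z ∈ S := hcubeS j hj z hz
    have hcb := commutator_bound hMh1 a hn hnk hρd hρ0 hη0 w aw hw0 (by linarith [(haw 1 le_rfl).1]) (haw 1 le_rfl).2 hw K hK S hS hs1 hρs
      (gAxf u) (gBxf u) (A := C' * N) (B := CW * N) (by positivity) (by positivity) (hAbound u N hN hu) (hBbound u N hN hu)
      (fun z hz => hgBx0 u z (fun h => hz (wall_subset hd (ℓ + 1) a M ρ k S (4 * s) h))) hzS hj hz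
    rw [hK₁]
    refine hcb.trans ?_
    -- `10(d+1)L²(C′+C_W)N/s ≤ N/2` since `s ≥ s₀ = 20(d+1)L²(C′+C_W)`
    rw [div_le_iff₀ hs0r]
    have : 10 * ((d : ℝ) + 1) * (((ℓ + 1 : ℕ) : ℝ)) ^ 2 * (C' * N + CW * N) = (s₀ / 2) * N := by rw [hs₀]; ring
    rw [this]
    have hN2 : 0 ≤ N / 2 := by positivity
    nlinarith
  -- (iv) the identity `ψ u x = P u x − ψ (K₁u) x` on `S`, from `T·P = 1 + K₁` and `T⁻¹T = 1`
  have hTunit : IsUnit T := by rw [hT]; exact isUnit_flatMatrix hd hη0 (ℓ + 1) n (cubeLamS (ℓ + 1) a M ρ k n) w hw0 K hK S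
  have hTT : T⁻¹ * T = 1 := Matrix.nonsing_inv_mul T ((Matrix.isUnit_iff_isUnit_det T).mp hTunit)
  have hident : ∀ u (x : ↥S), ψ u x.1 = Pf u x.1 - ψ (K₁ u) x.1 := by
    intro u x
    -- `T·(P u) = u + K₁u` at every row
    have hrow : ∀ z : ↥S, ∑ y : ↥S, T z y * Pf u y.1 = u z.1 + K₁ u z.1 := by
      intro z
      have hpi := parametrix_identity hℓ hMh1 a hn hnk hρd hMd hρ0 hR hη0 w aw hw0 hawpos hw K hK S hS hs1 (mW := 4 * s) le_rfl u
        (uAf u) (huAf u) (gAxf u) (hgAx_pull u) (uBf u) (huBf u) (gBxf u) (hgBx_mem u) (hgBx0 u) z.2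
      rw [hK₁, ← hpi, ← Finset.sum_coe_sort S]
      refine Finset.sum_congr rfl fun y _ => ?_
      rw [hT, Matrix.of_apply, hPf]
    -- apply `T⁻¹`
    have h1 : ∑ z : ↥S, T⁻¹ x z * (u z.1 + K₁ u z.1) = Pf u x.1 := by
      calc ∑ z : ↥S, T⁻¹ x z * (u z.1 + K₁ u z.1)
          = ∑ z : ↥S, T⁻¹ x z * ∑ y : ↥S, T z y * Pf u y.1 := Finset.sum_congr rfl fun z _ => by rw [hrow z]
        _ = ∑ y : ↥S, (∑ z : ↥S, T⁻¹ x z * T z y) * Pf u y.1 := by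
            simp_rw [Finset.mul_sum]
            rw [Finset.sum_comm]
            refine Finset.sum_congr rfl fun y _ => ?_
            rw [Finset.sum_mul]
            refine Finset.sum_congr rfl fun z _ => ?_
            ring
        _ = ∑ y : ↥S, (T⁻¹ * T) x y * Pf u y.1 := Finset.sum_congr rfl fun y _ => by rw [Matrix.mul_apply]
        _ = Pf u x.1 := by
            rw [hTT]
            simp_rw [Matrix.one_apply, ite_mul, one_mul, zero_mul]
            rw [Finset.sum_ite_eq]; simp
    have hψx : ψ u x.1 = ∑ z : ↥S, T⁻¹ x z * u z.1 := by rw [hψ, dif_pos x.2]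
    have hψK : ψ (K₁ u) x.1 = ∑ z : ↥S, T⁻¹ x z * K₁ u z.1 := by rw [hψ, dif_pos x.2]
    rw [hψx, hψK, ← h1, ← Finset.sum_sub_distrib]
    refine Finset.sum_congr rfl fun z _ => ?_
    ring
  -- (v) the crude bound
  have hcrude : ∀ (x : ↥S) u N, 0 ≤ N → BW u N → |ψ u x.1| ≤ ((η ^ 2)⁻¹ * ∑ z : ↥S, |T⁻¹ x z|) * N := by
    intro x u N hN hu
    rw [hBW] at hu
    rw [hψ, dif_pos x.2, Finset.mul_sum, Finset.sum_mul]
    refine (Finset.abs_sum_le_sum_abs _ _).trans (Finset.sum_le_sum fun z _ => ?_)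
    rw [abs_mul]
    have hz0 : z.1 ∈ cube (ℓ + 1) a M ρ k 0 := by rw [← cubeFam_false_of_le (ℓ + 1) a M ρ (Nat.zero_le k)]; exact (hS z.1).mp z.2
    have hb := hu 0 (Nat.zero_le n) z.1 hz0
    rw [pow_zero, one_mul] at hb
    have hη2 : 0 < η ^ 2 := by positivity
    have : |u z.1| ≤ (η ^ 2)⁻¹ * N := by rw [le_inv_mul_iff₀ hη2]; exact hb
    calc |T⁻¹ x z| * |u z.1| ≤ |T⁻¹ x z| * ((η ^ 2)⁻¹ * N) := mul_le_mul_of_nonneg_left this (abs_nonneg _)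
      _ = (η ^ 2)⁻¹ * |T⁻¹ x z| * N := by ring
  -- (vi) the source `ρ′` extended by zero, of size `r`
  obtain ⟨u₀, hu₀⟩ : ∃ u₀ : (Fin (d + 1) → ℤ) → ℝ, ∀ z, u₀ z = if h : z ∈ S then ρ' ⟨z, h⟩ else 0 := ⟨_, fun _ => rfl⟩
  have hBWu₀ : BW u₀ r := by
    rw [hBW]
    intro j hj z hz
    have hzS : z ∈ S := hcubeS j hj z hz
    rw [hu₀, dif_pos hzS]
    have h := hρ' j hj ⟨z, hzS⟩ (by rw [cubeFam_false_of_le _ a M ρ (hj.trans hnk)]; exact hz)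
    simpa [wt] using h
  -- the function member at every site
  have hsup : ∀ x₀, |φ x₀| ≤ 2 * (C' + CW) * r := by
    intro x₀
    by_cases hx₀ : x₀ ∈ S
    · have hmain := apriori_functional_bound BW K₁ (fun u => ψ u x₀) (fun u => Pf u x₀) (C := C' + CW)
        (B₀ := (η ^ 2)⁻¹ * ∑ z : ↥S, |T⁻¹ ⟨x₀, hx₀⟩ z|) (by positivity)
        (fun u => hident u ⟨x₀, hx₀⟩) (fun u N hN hu => hPbound u N hN hu x₀) hKhalf (fun u N hN hu => hcrude ⟨x₀, hx₀⟩ u N hN hu)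
        u₀ hr hBWu₀
      have hφψ : φ x₀ = ψ u₀ x₀ := by
        rw [hφ ⟨x₀, hx₀⟩, hψ, dif_pos hx₀]
        refine Finset.sum_congr rfl fun z _ => ?_
        rw [hu₀, dif_pos z.2]
      rw [hφψ]
      simpa [mul_assoc] using hmain
    · rw [hφ0 x₀ (fun h => hx₀ ((hS x₀).mpr h)), abs_zero]
      positivity
  have hCC : 0 ≤ C' + CW := by positivity
  refine ⟨fun x₀ => (hsup x₀).trans ?_, ?_⟩
  · have h0 : 0 ≤ (C' + CW) * r := mul_nonneg hCC hr
    nlinarith [mul_le_mul_of_nonneg_right hLr h0]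
  -- THE GRADIENT MEMBER
  intro j hj p hp
  simp only [Set.mem_setOf_eq] at hp
  obtain ⟨y, μ⟩ := p
  dsimp only at hp ⊢
  have hwt : wt (ℓ + 1) η j * |η⁻¹ * (φ (y + e μ) - φ y)| = (((ℓ + 1 : ℕ) : ℝ)) ^ j * |φ (y + e μ) - φ y| := by
    unfold wt
    rw [abs_mul, abs_inv, abs_of_pos hη]
    field_simp
  rw [hwt]
  by_cases hj1 : j ≤ 1
  · -- shallow bonds: the function member and `Lʲ ≤ L`
    have hLj : (((ℓ + 1 : ℕ) : ℝ)) ^ j ≤ ((ℓ + 1 : ℕ) : ℝ) := by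
      calc (((ℓ + 1 : ℕ) : ℝ)) ^ j ≤ (((ℓ + 1 : ℕ) : ℝ)) ^ 1 := pow_le_pow_right₀ hLr hj1
        _ = _ := pow_one _
    have h1 := hsup (y + e μ)
    have h2 := hsup y
    calc (((ℓ + 1 : ℕ) : ℝ)) ^ j * |φ (y + e μ) - φ y|
        ≤ ((ℓ + 1 : ℕ) : ℝ) * (|φ (y + e μ)| + |φ y|) := mul_le_mul hLj (abs_sub _ _) (abs_nonneg _) (by positivity)
      _ ≤ ((ℓ + 1 : ℕ) : ℝ) * (2 * (C' + CW) * r + 2 * (C' + CW) * r) := mul_le_mul_of_nonneg_left (add_le_add h1 h2) (by positivity)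
      _ = 4 * (((ℓ + 1 : ℕ) : ℝ)) * (C' + CW) * r := by ring
  · -- deep bonds: both ends near `□_j ⊂ □₂`
    push Not at hj1
    have hjk : j ≤ k := hj.trans hnk
    rw [cubeFam_false_of_le _ a M ρ hjk] at hp
    obtain ⟨c, hc, hyc, hyc'⟩ := close_of_sideTouches hp
    have hρ1 : 1 ≤ ρ := le_trans hL hρL
    have hy1 : y ∈ cube (ℓ + 1) a M ρ k (j - 1) := mem_cube_pred_of_close hL a M hρ1 (by omega) hjk hc hyc
    have hy1' : y + e μ ∈ cube (ℓ + 1) a M ρ k (j - 1) := mem_cube_pred_of_close hL a M hρ1 (by omega) hjk hc hyc'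
    have hyS : y ∈ S := hcubeS (j - 1) (by omega) y hy1
    have hyS' : y + e μ ∈ S := hcubeS (j - 1) (by omega) _ hy1'
    -- depth: `c ∈ □_j ⊂ □₂` is deeper than `ρL`, the ends are within `d + 1`
    have hk2 : 2 ≤ k := le_trans hj1 hjk
    have hc2 : c ∈ cube (ℓ + 1) a M ρ k 2 := by
      have hsub := B8Eq191FlatLettersCubeMember.cubeFam_antitone hL a M hρL k hj1
      rw [cubeFam_false_of_le _ a M ρ hjk, cubeFam_false_of_le _ a M ρ hk2] at hsub
      exact hsub hc
    have hcd := B8Eq191FlatDirichletDepth.depth_ge_of_mem_inner hd a M ρ (show 1 < 2 by norm_num) hk2 hc2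
    rw [pow_one] at hcd
    have hℓ1 : (1 : ℤ) ≤ ℓ := by exact_mod_cast hℓ
    have hD0 : (0 : ℤ) ≤ ((d + 1 : ℕ) : ℤ) := by positivity
    have h4 : 4 * (s : ℤ) + ((d + 1 : ℕ) : ℤ) * (ℓ : ℤ) ≤ (ρ : ℤ) * ((ℓ + 1 : ℕ) : ℤ) := by exact_mod_cast hs4
    have hprod : ((d + 1 : ℕ) : ℤ) * 1 ≤ ((d + 1 : ℕ) : ℤ) * (ℓ : ℤ) := mul_le_mul_of_nonneg_left hℓ1 hD0
    have hdy : 4 * (s : ℤ) ≤ depth hd (ℓ + 1) a M ρ k 1 y := by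
      have h := depth_ge_of_close hd (ℓ + 1) a M ρ k hyc
      linarith
    have hdy' : 4 * (s : ℤ) ≤ depth hd (ℓ + 1) a M ρ k 1 (y + e μ) := by
      have h := depth_ge_of_close hd (ℓ + 1) a M ρ k hyc'
      linarith
    -- the level of `y + t` is at least `j − 1`
    have hlev : j - 1 ≤ lev ℓ Mh a M ρ k n (y + shift ℓ Mh a ρ k n) := by
      refine (B8CubeMemberBoxDomains.le_lev_iff a M hρL hnk (show 1 ≤ j - 1 by omega) (show j - 1 ≤ n by omega)
        (y + shift ℓ Mh a ρ k n) ?_ (Mh := Mh)).mpr ?_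
      · intro hj1eq
        rw [B8CubeMemberBoxDomains.add_shift_sub_shift]
        rw [hj1eq] at hy1
        exact hy1
      · rw [B8CubeMemberBoxDomains.add_shift_sub_shift]; exact hy1
    -- the gradient functional and its a-priori bound
    have hPgrad : ∀ u N, 0 ≤ N → BW u N →
        |(((ℓ + 1 : ℕ) : ℝ)) ^ j * (Pf u (y + e μ) - Pf u y)| ≤ ((ℓ + 1 : ℕ) : ℝ) * C' * N := by
      intro u N hN hu
      have hpg := parametrix_grad_deep (d := d) (η := η) (s := s) (y := y) hℓ hMh1 a hn hnk aw hs1 (uAf u) (gAxf u) (hgAx_pull u) (gBxf u) μ hdy hdy'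
      obtain ⟨h₁, h₂, hgrad⟩ := hpg
      have hdiff : Pf u (y + e μ) - Pf u y
          = η ^ 2 * (dMat (N0 ℓ Mh n (boxP ℓ M ρ k n)) μ *ᵥ
              (gml (N0 ℓ Mh n (boxP ℓ M ρ k n)) ℓ n (lev ℓ Mh a M ρ k n) aw *ᵥ uAf u)) ⟨y + shift ℓ Mh a ρ k n, h₁⟩ := by
        rw [hPf, hPf]; exact hgrad
      rw [hdiff]
      have hb := hAgrad u N hN hu ⟨y + shift ℓ Mh a ρ k n, h₁⟩ μ
      rw [abs_mul, abs_of_nonneg (by positivity), abs_mul, abs_of_nonneg (by positivity : (0 : ℝ) ≤ η ^ 2)]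
      -- `Lʲ · C′N·(L^{lev})⁻¹ ≤ L·C′N` since `lev ≥ j − 1`
      have hcast : ((ℓ : ℝ) + 1) = ((ℓ + 1 : ℕ) : ℝ) := by push_cast; ring
      rw [hcast] at hb
      have hpow : (((ℓ + 1 : ℕ) : ℝ)) ^ j * ((((ℓ + 1 : ℕ) : ℝ)) ^ lev ℓ Mh a M ρ k n (y + shift ℓ Mh a ρ k n))⁻¹ ≤ ((ℓ + 1 : ℕ) : ℝ) := by
        obtain ⟨m, hm⟩ : ∃ m, lev ℓ Mh a M ρ k n (y + shift ℓ Mh a ρ k n) = (j - 1) + m := ⟨_, (Nat.add_sub_cancel' hlev).symm⟩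
        rw [hm, show j = (j - 1) + 1 by omega, Nat.add_sub_cancel, pow_add, pow_add, pow_one, mul_inv]
        have hL1 : 0 < (((ℓ + 1 : ℕ) : ℝ)) ^ (j - 1) := by positivity
        have hLm : 1 ≤ (((ℓ + 1 : ℕ) : ℝ)) ^ m := one_le_pow₀ hLr
        calc (((ℓ + 1 : ℕ) : ℝ)) ^ (j - 1) * ((ℓ + 1 : ℕ) : ℝ) * (((((ℓ + 1 : ℕ) : ℝ)) ^ (j - 1))⁻¹ * ((((ℓ + 1 : ℕ) : ℝ)) ^ m)⁻¹)
            = ((ℓ + 1 : ℕ) : ℝ) * ((((ℓ + 1 : ℕ) : ℝ)) ^ m)⁻¹ := by field_simp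
          _ ≤ ((ℓ + 1 : ℕ) : ℝ) * 1 := mul_le_mul_of_nonneg_left (inv_le_one_of_one_le₀ hLm) (by positivity)
          _ = _ := mul_one _
      calc (((ℓ + 1 : ℕ) : ℝ)) ^ j * (η ^ 2 * |(dMat (N0 ℓ Mh n (boxP ℓ M ρ k n)) μ *ᵥ
              (gml (N0 ℓ Mh n (boxP ℓ M ρ k n)) ℓ n (lev ℓ Mh a M ρ k n) aw *ᵥ uAf u)) ⟨y + shift ℓ Mh a ρ k n, h₁⟩|)
          ≤ (((ℓ + 1 : ℕ) : ℝ)) ^ j * (C' * N * ((((ℓ + 1 : ℕ) : ℝ)) ^ lev ℓ Mh a M ρ k n (y + shift ℓ Mh a ρ k n))⁻¹) :=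
            mul_le_mul_of_nonneg_left hb (by positivity)
        _ = ((((ℓ + 1 : ℕ) : ℝ)) ^ j * ((((ℓ + 1 : ℕ) : ℝ)) ^ lev ℓ Mh a M ρ k n (y + shift ℓ Mh a ρ k n))⁻¹) * (C' * N) := by ring
        _ ≤ ((ℓ + 1 : ℕ) : ℝ) * (C' * N) := mul_le_mul_of_nonneg_right hpow (by positivity)
        _ = ((ℓ + 1 : ℕ) : ℝ) * C' * N := by ring
    have hgradmain := apriori_functional_bound BW K₁ (fun u => (((ℓ + 1 : ℕ) : ℝ)) ^ j * (ψ u (y + e μ) - ψ u y))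
      (fun u => (((ℓ + 1 : ℕ) : ℝ)) ^ j * (Pf u (y + e μ) - Pf u y)) (C := ((ℓ + 1 : ℕ) : ℝ) * C')
      (B₀ := (((ℓ + 1 : ℕ) : ℝ)) ^ j * (((η ^ 2)⁻¹ * ∑ z : ↥S, |T⁻¹ ⟨y + e μ, hyS'⟩ z|) + ((η ^ 2)⁻¹ * ∑ z : ↥S, |T⁻¹ ⟨y, hyS⟩ z|)))
      (by positivity)
      (fun u => by
        show (((ℓ + 1 : ℕ) : ℝ)) ^ j * (ψ u (y + e μ) - ψ u y)
          = (((ℓ + 1 : ℕ) : ℝ)) ^ j * (Pf u (y + e μ) - Pf u y) - (((ℓ + 1 : ℕ) : ℝ)) ^ j * (ψ (K₁ u) (y + e μ) - ψ (K₁ u) y)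
        rw [hident u ⟨y + e μ, hyS'⟩, hident u ⟨y, hyS⟩]; ring)
      hPgrad hKhalf
      (fun u N hN hu => by
        show |(((ℓ + 1 : ℕ) : ℝ)) ^ j * (ψ u (y + e μ) - ψ u y)| ≤ _
        have h1 := hcrude ⟨y + e μ, hyS'⟩ u N hN hu
        have h2 := hcrude ⟨y, hyS⟩ u N hN hu
        rw [abs_mul, abs_of_nonneg (by positivity)]
        calc (((ℓ + 1 : ℕ) : ℝ)) ^ j * |ψ u (y + e μ) - ψ u y|
            ≤ (((ℓ + 1 : ℕ) : ℝ)) ^ j * (|ψ u (y + e μ)| + |ψ u y|) := mul_le_mul_of_nonneg_left (abs_sub _ _) (by positivity)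
          _ ≤ (((ℓ + 1 : ℕ) : ℝ)) ^ j * ((((η ^ 2)⁻¹ * ∑ z : ↥S, |T⁻¹ ⟨y + e μ, hyS'⟩ z|) * N) + (((η ^ 2)⁻¹ * ∑ z : ↥S, |T⁻¹ ⟨y, hyS⟩ z|) * N)) :=
              mul_le_mul_of_nonneg_left (add_le_add h1 h2) (by positivity)
          _ = _ := by ring)
      u₀ hr hBWu₀
    -- `φ = ψ u₀` on `S`
    have hφψ : ∀ (x : ↥S), φ x.1 = ψ u₀ x.1 := by
      intro x
      rw [hφ x, hψ, dif_pos x.2]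
      refine Finset.sum_congr rfl fun z _ => ?_
      rw [hu₀, dif_pos z.2]
    rw [hφψ ⟨y + e μ, hyS'⟩, hφψ ⟨y, hyS⟩]
    change |(((ℓ + 1 : ℕ) : ℝ)) ^ j * (ψ u₀ (y + e μ) - ψ u₀ y)| ≤ 2 * (((ℓ + 1 : ℕ) : ℝ) * C') * r at hgradmain
    rw [abs_mul, abs_of_nonneg (by positivity)] at hgradmain
    calc (((ℓ + 1 : ℕ) : ℝ)) ^ j * |ψ u₀ (y + e μ) - ψ u₀ y| ≤ 2 * (((ℓ + 1 : ℕ) : ℝ) * C') * r := hgradmain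
      _ ≤ 4 * (((ℓ + 1 : ℕ) : ℝ)) * (C' + CW) * r := by
          have h1 : 0 ≤ ((ℓ + 1 : ℕ) : ℝ) * r := mul_nonneg hLpos.le hr
          have h2 : 2 * (((ℓ + 1 : ℕ) : ℝ) * C') * r = (2 * C') * (((ℓ + 1 : ℕ) : ℝ) * r) := by ring
          have h3 : 4 * (((ℓ + 1 : ℕ) : ℝ)) * (C' + CW) * r = (4 * (C' + CW)) * (((ℓ + 1 : ℕ) : ℝ) * r) := by ring
          rw [h2, h3]
          exact mul_le_mul_of_nonneg_right (by linarith) h1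


end Literature.MathematicalPhysics.QuantumFieldTheory.Balaban1983to89.B8Eq1101CubeMemberRealGrad
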